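import Summits.ResolutionOfSingularities.ResolutionOfSingularities.Theorems.WeightedInvariantIota3TieZeroTransformShape
import Summits.ResolutionOfSingularities.ResolutionOfSingularities.Theorems.WeightedInvariantIota3DropTypeA
import Summits.ResolutionOfSingularities.ResolutionOfSingularities.Theorems.WeightedInvariantKeyRungThreeOfDropB
import Summits.ResolutionOfSingularities.ResolutionOfSingularities.Theorems.WeightedInvariantIota3Regimes
import Summits.ResolutionOfSingularities.ResolutionOfSingularities.Theorems.WeightedInvariantIota3EpsStratumRing
import HarnessLib

/-!
# (ISO) at the pinned successor, ON THE EXCEPTIONAL DIVISOR: the transform is equimultiple along no curve through the pinned point that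
# meets `V(t⁻¹)` — so (ISO) ⟸ (ISO-OFF) (door `HypersurfaceCentreConstruction`, stmt-ResolutionOfSingularities-19897)

Helper for `stub_keyRungGrHomLE_three` (def-free, `--supports 19897`).  Sequel of this hand's …Iota3CurveFracTieZeroSigmaReduction
((D-b³-curve-FRAC-TIE-ZERO) ⟸ (ISO) + (SIGMA)) on top of hand -9's pin / transform shape and hand -7's TYPE (a) machinery.

* **`Iota3.isIsolatedPosition_transform_of_offExceptional_aux`** — at a curve-centre door position `(S, f)` (`topStratum ι₀ S f = V(P)`,
  `P = (x, y)` of height two, `dim S = 3`), with the AQS-adapted normal form `f = c y^ν + h` (`c` a unit, `h ∈ 𝒥_{bν+1}((y,x);(b,1))`,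
  `J₃ᵗ = 𝒥((y,x);(b,1))`), at the pinned prime `𝔫 = (t⁻¹, z, W)` (`y = (t⁻¹)^b W`) off the vertex, for every saturated transform `g` whose
  order at `B_𝔫` is `ord f`: **`(B_𝔫, g/1)` is an ISOLATED position** (`topStratum iotaOrd (B_𝔫) (g/1) = {𝔪}`) PROVIDED
  (ISO-OFF) the order of `g` drops at every prime `𝔮 ⊆ 𝔫` NOT containing `t⁻¹` (the successors off the exceptional divisor).
  Proof, for the primes `𝔮 ∋ t⁻¹`: `g = c W^ν + t⁻¹ H` (…TieZeroTransformShape) forces `W ∈ 𝔮` as soon as `g ∈ 𝔮`, so `𝔮 ∌ z` unless `𝔮 = 𝔫`;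
  then `𝔮 ∩ S` is a prime between `P` and `𝔪` other than `𝔪`, i.e. `P` (heights), and `𝔮` is a successor over the GENERIC point of the
  centre, where the ORDER drops by the P2 canonical game clause (`ContactCylinder.iota_successor_lt_of_over_generic_point_of_clause`, as in
  hand -7's TYPE (a)); `𝔮 ∌ g` gives order `0`.  The equimultiple locus is then read on the chart by res-type-078's
  `topStratum_iotaOrd_eq_setOf_map_le`.
* So the curve regime's (ISO) is cut to **(ISO-OFF)**: «at a prime `𝔮 ⊊ 𝔫` of the cobordant algebra with `t⁻¹ ∉ 𝔮`,
  `iotaOrd (B_𝔮) (g/1) < iotaOrd S f`» — off `V(t⁻¹)` the cobordant blow-up is `Spec S[t, t⁻¹]` (Włodarczyk Def. 2.3.5, tree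
  `OffExceptional.isLocalization_away_tInv`), `g` is a unit multiple of `f` there and `𝔮 ∩ S ⊉ P` (as `x = t⁻¹ X` with `X ∉ 𝔫`), so this is the
  flat-with-regular-fibre order comparison `ord_{S[t,t⁻¹]_𝔮}(f) = ord_{S_{𝔮 ∩ S}}(f) < ν` [S–M; Literature `OrderFlatLocalHom`].

[OURS · L1 W4.3 · audit glue; AI work, weaker than expert review; nothing here is a statement of the manuscript under review
(Hironaka 2017, [claim: Hironaka2017, status: under-review]).]

## References

* J. Włodarczyk, *Functorial resolution by torus actions*, arXiv:2203.03090, Def. 2.3.5, §3.3. [Wlodarczyk2022]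
* V. Cossart, U. Jannsen, S. Saito, *Desingularization: invariants and strategy*, LNM 2270 (2020), Ch. 8. [CossartJannsenSaito2020]
-/

noncomputable section

set_option linter.dupNamespace false -- mandated namespace of this single-conjunct summit

open IsLocalRing Literature.AlgebraicGeometry.Resolution
open Summit.ResolutionOfSingularities.ResolutionOfSingularities.Theorems
open Summit.ResolutionOfSingularities.ResolutionOfSingularities.Theorems.ContactCylinder

namespace Summit.ResolutionOfSingularities.ResolutionOfSingularities.Cruxes.HypersurfaceCentreConstruction.LocalEngine

namespace Iota3

/-- **The ORDER drops at every prime `𝔮 ∋ t⁻¹` strictly inside the pinned point `𝔫 = (t⁻¹, z, W)`** (curve-centre door position,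
AQS-adapted normal form, integer weights `(b, 1)`; `![y, x]`-presentation): such a `𝔮` either misses `g` (order `0`) or is a successor over
the GENERIC point `P` of the centre (TYPE (a): the P2 canonical game clause drops the order). [OURS · L1 W4.3 · (ISO), exceptional part]
[cite: Wlodarczyk2022, §3.3] [cite: CossartJannsenSaito2020, Ch. 8] -/
theorem iotaOrd_lt_of_tInv_mem_of_lt_pin (p : ℕ) (k₀ : Type) [Field k₀] [CharP k₀ p] [PerfectField k₀]
    (S : Type) [CommRing S] [IsRegularLocalRing S] [Algebra k₀ S] [Algebra.EssFiniteType k₀ S]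
    {f : S} (hd : ringKrullDim S = 3) (hf0 : f ≠ 0) (hf2 : f ∈ (maximalIdeal S) ^ 2)
    (P : Ideal S) [P.IsPrime] (hE : topStratum iotaOrdEpsTau S f = {𝔮 | P ≤ 𝔮.asIdeal})
    (hP1 : ¬ ringKrullDim (Localization.AtPrime P) ≤ 1)
    {y x z : S} {b ν : ℕ} {c h : S} (hyxz : Ideal.span (Set.range ![y, x, z]) = maximalIdeal S)
    (hrk : (maximalIdeal S).spanFinrank = 3) (hPeq : P = Ideal.span {x, y}) (hb : 1 ≤ b)
    (hfν1 : f ∉ maximalIdeal S ^ (ν + 1)) (hadm : f ∈ weightedMonomialIdeal ![y, x] ![b, 1] (b * ν)) (hc : IsUnit c)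
    (hh : h ∈ weightedMonomialIdeal ![y, x] ![b, 1] (b * ν + 1)) (hf : f = c * y ^ ν + h)
    (hJ : ∀ m : ℕ, weightedMonomialIdeal ![y, x] ![b, 1] m = jFlatT S f m)
    (𝔫 : Ideal (cobordantAlgebra' ![y, x] ![b, 1]))
    (hV : ¬ extReesAlgebra.vertexIdeal (weightedMonomialIdeal ![y, x] ![b, 1]) ≤ 𝔫)
    (W : cobordantAlgebra' ![y, x] ![b, 1]) (hW : algebraMap S _ y = cobordantT' ![y, x] ![b, 1] ^ b * W)
    (h𝔫 : 𝔫 = Ideal.span {cobordantT' ![y, x] ![b, 1], algebraMap S _ z, W})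
    {a : ℕ} {g : cobordantAlgebra' ![y, x] ![b, 1]} (hfg : algebraMap S _ f = cobordantT' ![y, x] ![b, 1] ^ a * g)
    (hTg : ¬ cobordantT' ![y, x] ![b, 1] ∣ g)
    (𝔮 : Ideal (cobordantAlgebra' ![y, x] ![b, 1])) [𝔮.IsPrime] (hle : 𝔮 ≤ 𝔫) (hne : ¬ 𝔫 ≤ 𝔮)
    (hT : cobordantT' ![y, x] ![b, 1] ∈ 𝔮) :
    iotaOrd (Localization.AtPrime 𝔮) (algebraMap (cobordantAlgebra' ![y, x] ![b, 1]) (Localization.AtPrime 𝔮) g) <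
      iotaOrd S f := by
  classical
  haveI : IsDomain S := isDomain_of_isRegularLocalRing S
  have h2 : ((2 : ℕ) : Ordinal) ≤ iotaOrd S f := (natCast_le_iotaOrd_iff S f 2).mpr hf2
  by_cases hg𝔮 : g ∈ 𝔮
  swap
  · -- `g ∉ 𝔮`: `g/1` is a unit, order `0 < 2 ≤ ord f`
    have hu : IsUnit (algebraMap (cobordantAlgebra' ![y, x] ![b, 1]) (Localization.AtPrime 𝔮) g) :=
      IsLocalization.map_units (Localization.AtPrime 𝔮) (⟨g, hg𝔮⟩ : 𝔮.primeCompl)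
    rw [iotaOrd_of_isUnit hu]
    have h02 : (0 : Ordinal) < ((2 : ℕ) : Ordinal) := by exact_mod_cast Nat.zero_lt_two
    exact lt_of_lt_of_le h02 h2
  -- `g ∈ 𝔮 ∋ t⁻¹`: `W ∈ 𝔮`, hence `z ∉ 𝔮` (else `𝔫 ≤ 𝔮`)
  obtain ⟨H, hH⟩ := exists_transform_eq_of_normalForm hyxz hrk Nat.one_pos hb hfν1 hadm hh hf ![y, x] ![b, 1] (fun _ => rfl) W hW
    hfg hTg
  have hW𝔮 : W ∈ 𝔮 := by
    have h1 : algebraMap S _ c * W ^ ν ∈ 𝔮 := by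
      have h2 : algebraMap S _ c * W ^ ν = g - cobordantT' ![y, x] ![b, 1] * H := by rw [hH]; ring
      rw [h2]
      exact Ideal.sub_mem _ hg𝔮 (Ideal.mul_mem_right _ _ hT)
    rcases (Ideal.IsPrime.mem_or_mem ‹_› h1) with hc𝔮 | hW'
    · exact absurd (Ideal.eq_top_of_isUnit_mem _ hc𝔮 (hc.map _)) (Ideal.IsPrime.ne_top ‹_›)
    · exact Ideal.IsPrime.mem_of_pow_mem ‹_› ν hW'
  have hz𝔮 : algebraMap S _ z ∉ 𝔮 := fun hz => hne (by
    rw [h𝔫, Ideal.span_le]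
    rintro _ (rfl | rfl | rfl)
    exacts [hT, hz, hW𝔮])
  -- `𝔮 ∩ S = P`
  haveI hQ : (𝔮.comap (algebraMap S (cobordantAlgebra' ![y, x] ![b, 1]))).IsPrime := Ideal.IsPrime.comap _
  have hx𝔮 : algebraMap S (cobordantAlgebra' ![y, x] ![b, 1]) x ∈ 𝔮 := by
    rw [LocalGameEFTCylinder.algebraMap_x_eq, pow_one]
    exact Ideal.mul_mem_right _ _ hT
  have hy𝔮 : algebraMap S (cobordantAlgebra' ![y, x] ![b, 1]) y ∈ 𝔮 := by
    rw [hW]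
    exact Ideal.mul_mem_right _ _ (Ideal.pow_mem_of_mem _ hT _ hb)
  have hPQ : P ≤ 𝔮.comap (algebraMap S (cobordantAlgebra' ![y, x] ![b, 1])) := by
    rw [hPeq, Ideal.span_le]
    rintro _ (rfl | rfl)
    exacts [hx𝔮, hy𝔮]
  have hP𝔮 : P.map (algebraMap S (cobordantAlgebra' ![y, x] ![b, 1])) ≤ 𝔮 := Ideal.map_le_iff_le_comap.mpr hPQ
  have hzm : z ∈ maximalIdeal S := hyxz ▸ Ideal.subset_span ⟨2, rfl⟩
  have hQm : 𝔮.comap (algebraMap S (cobordantAlgebra' ![y, x] ![b, 1])) ≠ maximalIdeal S := by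
    intro hQm
    have hz' : z ∈ 𝔮.comap (algebraMap S (cobordantAlgebra' ![y, x] ![b, 1])) := by rw [hQm]; exact hzm
    exact hz𝔮 (Ideal.mem_comap.mp hz')
  have hQlt : 𝔮.comap (algebraMap S (cobordantAlgebra' ![y, x] ![b, 1])) < maximalIdeal S :=
    lt_of_le_of_ne (IsLocalRing.le_maximalIdeal hQ.ne_top) hQm
  have hQ2 : (𝔮.comap (algebraMap S (cobordantAlgebra' ![y, x] ![b, 1]))).height ≤ ((2 : ℕ) : ℕ∞) :=
    height_le_of_lt_of_height_le hQlt (height_maximalIdeal_le_of_ringKrullDim_le_three (le_of_eq hd))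
  have hQP : 𝔮.comap (algebraMap S (cobordantAlgebra' ![y, x] ![b, 1])) = P := by
    by_contra hQP
    have hPlt : P < 𝔮.comap (algebraMap S (cobordantAlgebra' ![y, x] ![b, 1])) := lt_of_le_of_ne hPQ (Ne.symm hQP)
    have hP1' : P.height ≤ ((1 : ℕ) : ℕ∞) :=
      height_le_of_lt_of_height_le hPlt (by
        have h11 : ((1 : ℕ) : ℕ∞) + 1 = ((2 : ℕ) : ℕ∞) := by norm_num
        rw [h11]
        exact hQ2)
    exact hP1 (by exact_mod_cast ringKrullDim_localization_le_of_height_le P hP1')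
  have hdimP : ringKrullDim (Localization.AtPrime P) ≤ 2 := by
    exact_mod_cast ringKrullDim_localization_le_of_height_le P (hQP ▸ hQ2)
  -- `g/1 ∈ 𝔪_{B_𝔮}²` or the order is `≤ 1 < 2`
  by_cases hg2 : algebraMap (cobordantAlgebra' ![y, x] ![b, 1]) (Localization.AtPrime 𝔮) g ∈
      maximalIdeal (Localization.AtPrime 𝔮) ^ 2
  swap
  · by_contra hlt
    have h2' : ((2 : ℕ) : Ordinal) ≤
        iotaOrd (Localization.AtPrime 𝔮) (algebraMap (cobordantAlgebra' ![y, x] ![b, 1]) (Localization.AtPrime 𝔮) g) :=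
      h2.trans (not_lt.mp hlt)
    exact hg2 ((natCast_le_iotaOrd_iff (Localization.AtPrime 𝔮)
      (algebraMap (cobordantAlgebra' ![y, x] ![b, 1]) (Localization.AtPrime 𝔮) g) 2).mp h2')
  -- TYPE (a): the P2 canonical game clause drops the order over the generic point of the centre
  have hf0' : algebraMap S (Localization.AtPrime P) f ≠ 0 := fun h0 =>
    hf0 ((injective_iff_map_eq_zero _).mp
      (IsLocalization.injective (Localization.AtPrime P) P.primeCompl_le_nonZeroDivisors) f h0)
  have hf2' : algebraMap S (Localization.AtPrime P) f ∈ maximalIdeal (Localization.AtPrime P) ^ 2 :=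
    algebraMap_mem_maximalIdeal_sq_of_topStratum S hf2 hE P le_rfl
  have hιP : iotaOrd (Localization.AtPrime P) (algebraMap S (Localization.AtPrime P) f) = iotaOrd S f := by
    have hmem : (⟨P, ‹_›⟩ : PrimeSpectrum S) ∈ topStratum iotaOrdEpsTau S f := by
      rw [hE]
      exact (le_rfl : P ≤ P)
    have h0 : iotaOrdEpsTau (Localization.AtPrime P) (algebraMap S (Localization.AtPrime P) f) = iotaOrdEpsTau S f := hmem
    exact ((iotaOrdEps_eq_iff _ _ _ _).mp ((iotaOrdEpsTau_eq_iff _ _ _ _).mp h0).1).1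
  have hJ' : ∀ m : ℕ, weightedMonomialIdeal ![y, x] ![b, 1] m =
      (jContact (Localization.AtPrime P) (algebraMap S (Localization.AtPrime P) f) m).comap
        (algebraMap S (Localization.AtPrime P)) := fun m => by
    rw [hJ m, jFlatT_eq_cylinderAt_jContact S f m hE hdimP, cylinderAt_def]
  have hval : ∀ m : ℕ, (weightedMonomialIdeal ![y, x] ![b, 1] m).map (algebraMap S (Localization.AtPrime P)) =
      jContact (Localization.AtPrime P) (algebraMap S (Localization.AtPrime P) f) m := fun m => by
    rw [hJ' m]
    exact IsLocalization.map_under P.primeCompl _ _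
  have hcontr : ∀ m : ℕ, ((weightedMonomialIdeal ![y, x] ![b, 1] m).map (algebraMap S (Localization.AtPrime P))).comap
      (algebraMap S (Localization.AtPrime P)) = weightedMonomialIdeal ![y, x] ![b, 1] m := fun m => by
    rw [hval m, ← hJ' m]
  have hdim2 : ringKrullDim (Localization.AtPrime P) ≤ (2 : ℕ) := by exact_mod_cast hdimP
  have hV' : ¬ extReesAlgebra.vertexIdeal (weightedMonomialIdeal ![y, x] ![b, 1]) ≤ 𝔮 := fun h' => hV (h'.trans hle)
  exact iota_successor_lt_of_over_generic_point_of_clause iotaOrd_isoInvariant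
    ((canonicalGameClauseLE_two_iff p iotaOrd jContact).mpr (LocalGameEFTDimTwoGame.canonicalGameClauseLE2_iotaOrd_jContact p))
    k₀ S P hdim2 f hf0' hf2' hιP ![y, x] ![b, 1] hcontr hval 𝔮 hT hP𝔮 hV' hQP.le a g hfg hTg hg2

/-- **(ISO) ⟸ (ISO-OFF) at the pinned successor**, `![y, x]`-presentation (aux form with a generalized filtration `I` for transport to every
presentation): if the ORDER of `g/1` at `B_𝔫` equals `ord f` and drops at every prime `𝔮 ⊆ 𝔫` with `t⁻¹ ∉ 𝔮`, then `(B_𝔫, g/1)` is an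
ISOLATED position. [OURS · L1 W4.3 · (ISO) ⟸ (ISO-OFF)] [cite: Wlodarczyk2022, §3.3] -/
theorem isIsolatedPosition_transform_of_offExceptional_aux (p : ℕ) (k₀ : Type) [Field k₀] [CharP k₀ p] [PerfectField k₀]
    (S : Type) [CommRing S] [IsRegularLocalRing S] [Algebra k₀ S] [Algebra.EssFiniteType k₀ S]
    {f : S} (hd : ringKrullDim S = 3) (hf0 : f ≠ 0) (hf2 : f ∈ (maximalIdeal S) ^ 2)
    (P : Ideal S) [P.IsPrime] (hE : topStratum iotaOrdEpsTau S f = {𝔮 | P ≤ 𝔮.asIdeal})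
    (hP1 : ¬ ringKrullDim (Localization.AtPrime P) ≤ 1)
    {y x z : S} {b ν : ℕ} {c h : S} (hyxz : Ideal.span (Set.range ![y, x, z]) = maximalIdeal S)
    (hrk : (maximalIdeal S).spanFinrank = 3) (hPeq : P = Ideal.span {x, y}) (hb : 1 ≤ b)
    (hfν1 : f ∉ maximalIdeal S ^ (ν + 1)) (hadm : f ∈ weightedMonomialIdeal ![y, x] ![b, 1] (b * ν)) (hc : IsUnit c)
    (hh : h ∈ weightedMonomialIdeal ![y, x] ![b, 1] (b * ν + 1)) (hf : f = c * y ^ ν + h)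
    {I : ℕ → Ideal S} (hI : I = weightedMonomialIdeal ![y, x] ![b, 1]) (hJ : ∀ m : ℕ, I m = jFlatT S f m)
    (𝔫 : Ideal (extReesAlgebra I)) [𝔫.IsPrime] (hV : ¬ extReesAlgebra.vertexIdeal I ≤ 𝔫)
    (W : extReesAlgebra I) (hW : algebraMap S _ y = extReesAlgebra.tInv I ^ b * W)
    (h𝔫 : 𝔫 = Ideal.span {extReesAlgebra.tInv I, algebraMap S _ z, W})
    {a : ℕ} {g : extReesAlgebra I} (hfg : algebraMap S _ f = extReesAlgebra.tInv I ^ a * g) (hTg : ¬ extReesAlgebra.tInv I ∣ g)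
    (hord : iotaOrd (Localization.AtPrime 𝔫) (algebraMap _ (Localization.AtPrime 𝔫) g) = iotaOrd S f)
    (hOFF : ∀ (𝔮 : Ideal (extReesAlgebra I)) [𝔮.IsPrime], 𝔮 ≤ 𝔫 → extReesAlgebra.tInv I ∉ 𝔮 →
      iotaOrd (Localization.AtPrime 𝔮) (algebraMap _ (Localization.AtPrime 𝔮) g) < iotaOrd S f) :
    IsIsolatedPosition (Localization.AtPrime 𝔫) (algebraMap _ (Localization.AtPrime 𝔫) g) := by
  subst hI
  have hJc : ∀ (𝔮 : Ideal (extReesAlgebra (weightedMonomialIdeal ![y, x] ![b, 1]))) [𝔮.IsPrime], 𝔮 ≤ 𝔫 →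
      (𝔫 ≤ 𝔮 ↔ iotaOrd (Localization.AtPrime 𝔮) (algebraMap _ (Localization.AtPrime 𝔮) g) =
        iotaOrd (Localization.AtPrime 𝔫) (algebraMap _ (Localization.AtPrime 𝔫) g)) := by
    intro 𝔮 _ hle
    constructor
    · intro hge
      obtain rfl : 𝔮 = 𝔫 := le_antisymm hle hge
      rfl
    · intro heq
      by_contra hne
      rw [hord] at heq
      by_cases hT : extReesAlgebra.tInv (weightedMonomialIdeal ![y, x] ![b, 1]) ∈ 𝔮
      · exact absurd heq (ne_of_lt (iotaOrd_lt_of_tInv_mem_of_lt_pin p k₀ S hd hf0 hf2 P hE hP1 hyxz hrk hPeq hb hfν1 hadm hc hh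
          hf (fun m => hJ m) 𝔫 hV W hW h𝔫 hfg hTg 𝔮 hle hne hT))
      · exact absurd heq (ne_of_lt (hOFF 𝔮 hle hT))
  have h := topStratum_iotaOrd_eq_setOf_map_le 𝔫 (Localization.AtPrime 𝔫) g 𝔫 hJc
  rw [Localization.AtPrime.map_eq_maximalIdeal] at h
  exact h

/-- **(ISO) ⟸ (ISO-OFF) at the pinned successor, EVERY presentation `(u, w)` of `J₃ᵗ = 𝒥((y,x);(b,1))`.** [OURS · L1 W4.3 · (ISO) ⟸ (ISO-OFF)]
[cite: Wlodarczyk2022, §3.3] -/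
theorem isIsolatedPosition_transform_of_offExceptional (p : ℕ) (k₀ : Type) [Field k₀] [CharP k₀ p] [PerfectField k₀]
    (S : Type) [CommRing S] [IsRegularLocalRing S] [Algebra k₀ S] [Algebra.EssFiniteType k₀ S]
    {f : S} (hd : ringKrullDim S = 3) (hf0 : f ≠ 0) (hf2 : f ∈ (maximalIdeal S) ^ 2)
    (P : Ideal S) [P.IsPrime] (hE : topStratum iotaOrdEpsTau S f = {𝔮 | P ≤ 𝔮.asIdeal})
    (hP1 : ¬ ringKrullDim (Localization.AtPrime P) ≤ 1)
    {y x z : S} {b ν : ℕ} {c h : S} (hyxz : Ideal.span (Set.range ![y, x, z]) = maximalIdeal S)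
    (hrk : (maximalIdeal S).spanFinrank = 3) (hPeq : P = Ideal.span {x, y}) (hb : 1 ≤ b)
    (hfν1 : f ∉ maximalIdeal S ^ (ν + 1)) (hadm : f ∈ weightedMonomialIdeal ![y, x] ![b, 1] (b * ν)) (hc : IsUnit c)
    (hh : h ∈ weightedMonomialIdeal ![y, x] ![b, 1] (b * ν + 1)) (hf : f = c * y ^ ν + h)
    {n : ℕ} (u : Fin n → S) (w : Fin n → ℕ) (hpres : ∀ m : ℕ, weightedMonomialIdeal u w m = weightedMonomialIdeal ![y, x] ![b, 1] m)
    (hJ : ∀ m : ℕ, weightedMonomialIdeal u w m = jFlatT S f m)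
    (𝔫 : Ideal (cobordantAlgebra' u w)) [𝔫.IsPrime] (hV : ¬ extReesAlgebra.vertexIdeal (weightedMonomialIdeal u w) ≤ 𝔫)
    (W : cobordantAlgebra' u w) (hW : algebraMap S (cobordantAlgebra' u w) y = cobordantT' u w ^ b * W)
    (h𝔫 : 𝔫 = Ideal.span {cobordantT' u w, algebraMap S (cobordantAlgebra' u w) z, W})
    {a : ℕ} {g : cobordantAlgebra' u w} (hfg : algebraMap S (cobordantAlgebra' u w) f = cobordantT' u w ^ a * g)
    (hTg : ¬ cobordantT' u w ∣ g)
    (hord : iotaOrd (Localization.AtPrime 𝔫) (algebraMap _ (Localization.AtPrime 𝔫) g) = iotaOrd S f)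
    (hOFF : ∀ (𝔮 : Ideal (cobordantAlgebra' u w)) [𝔮.IsPrime], 𝔮 ≤ 𝔫 → cobordantT' u w ∉ 𝔮 →
      iotaOrd (Localization.AtPrime 𝔮) (algebraMap _ (Localization.AtPrime 𝔮) g) < iotaOrd S f) :
    IsIsolatedPosition (Localization.AtPrime 𝔫) (algebraMap (cobordantAlgebra' u w) (Localization.AtPrime 𝔫) g) :=
  isIsolatedPosition_transform_of_offExceptional_aux p k₀ S hd hf0 hf2 P hE hP1 hyxz hrk hPeq hb hfν1 hadm hc hh hf (funext hpres)
    (fun m => hJ m) 𝔫 hV W hW h𝔫 hfg hTg hord hOFF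

end Iota3

end Summit.ResolutionOfSingularities.ResolutionOfSingularities.Cruxes.HypersurfaceCentreConstruction.LocalEngine

end
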